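import Summits.ResolutionOfSingularities.ResolutionOfSingularities.Theorems.EquisingularLiftEquisingularLiftNatNoseTowerBTriplePrimeSigmaOfFact
import Summits.ResolutionOfSingularities.ResolutionOfSingularities.Theorems.EquisingularLiftEquisingularLiftNatTowerBFourPRamGamma
import Summits.ResolutionOfSingularities.ResolutionOfSingularities.Theorems.EquisingularLiftEquisingularLiftNatNoseRoundStageOfModel
import HarnessLib

/-!
# [OURS · L1 W4.5(b) · EL♮(3) · WIDTH TABLE D13 «(P-ram-Γ) / E-ROUND», engine delta — tail closure] HSUB‴ΣPG: THE B‴ NOSE-TOWER ENGINE WITH THE Σ AND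
# THE (P-ram-Γ) TAIL RULES — `hsub_reachNoseTowerBTriplePrimeSigmaPG_of_fact'` — AND ITS STAGE TWINS `Equinodal.noseRound_stage_of_model_sigmaPG` /
# `Equinodal.directNose_stage_zero_of_model_sigmaPG` (stub-4's D12 files (2)+(3) in ONE module, to save one olean lag)

res-L1-w45b-stub-2 g20, SCRATCH for res-L1-w45b-stub-4 g15 (desk DESK WORD g26-12 GO; stub-4's D12 layout, file (2)).  = res-L1-w45b-stub-4's
⊙ `hsub_reachNoseTowerBTriplePrimeSigma_of_fact'` (`…NatNoseTowerBTriplePrimeSigmaOfFact`, p710482) VERBATIM with ONE more antecedent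
`TowerPRamGamma F₁ F₂ υ Z hZ R₁ →` in the tail's closure hypothesis (the D13 doors `ReachDirectPlanarNoseSigmaPG₂` / `ReachDirectCINoseSigmaPG₂` of
✓ `…NatResidueHypDefsE7`) discharged by ★★ `Tower.towerPRamGamma_invB₁_FE` (`…NatTowerBFourPRamGamma`); then the two stage twins = stub-4's draft `NoseRoundStageOfModelSigma.lean`
1c44a5f8ae36c4b2 VERBATIM with the same extra antecedent, fed to the new hsub (✓ `hendBlock_stage_zero_of_model` reused unchanged).  OURS; NOT a statement of any manuscript
([Hironaka2017] is a candidate under adjudication, nothing of it is asserted); AI-written, weaker than expert review.  No `sorry`; standard axioms;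
DEF-FREE.  `--supports stmt-ResolutionOfSingularities-20148 --as helper`, counted 0.  EL♮(3) is NOT proved by this file.
[cite: StacksProject, Tag 02NS and Tag 02OS] [cite: Liu2002, Thm. 8.1.19] [folklore; ✓ T23-A‴ engine (stub-4) + two closures]
-/

set_option linter.dupNamespace false -- mandated namespace `Summit.<Summit>.<Problem>` of this single-conjunct summit
set_option linter.overlappingInstances false -- signatures carry `[IsDomain O] [IsDiscreteValuationRing O]`

noncomputable section

open CategoryTheory CategoryTheory.Limits AlgebraicGeometry TopologicalSpace Topology IsLocalRing
open MvPolynomial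
open Literature.AlgebraicGeometry.Resolution
open AlgebraicGeometry.Scheme.IdealSheafData
open Summit.ResolutionOfSingularities.ResolutionOfSingularities.Theses.EquisingularLift.Split
open Summit.ResolutionOfSingularities.ResolutionOfSingularities.Cruxes.EquisingularLift.StrataSplit

namespace Summit.ResolutionOfSingularities.ResolutionOfSingularities.Cruxes.EquisingularLiftNat.Sections

/-- ★★ **HSUB‴Σ — THE B‴ NOSE-TOWER ENGINE WITH THE Σ-SECTION TAIL RULE** (WIDTH TABLE D12 engine delta): ✓ `hsub_reachNoseTowerBTriplePrime_of_fact'`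
(res-L1-w45b-stub-4 g11/g12, nose-w2 re-cut) VERBATIM with ONE more antecedent `TowerSecRoundSigma F₁ F₂ υ Z hZ R₁ →` in the tail's closure hypothesis
discharged by res-L1-w45b-stub-4's fourth closure ✓/⊙ `Tower.towerSecRoundSigma_invB₁_of_licence` (D12), and — D13 — ONE MORE antecedent
`TowerPRamGamma F₁ F₂ υ Z hZ R₁ →` (027's `ReachDirect…SigmaPG₂` doors, ✓ `…NatResidueHypDefsE7` p711287) discharged by the fifth closure
★★ `Tower.towerPRamGamma_invB₁_FE` (hypothesis-free: the E-round licence is the theorem `ERound.eRoundLift`).  The Σ-licence `hSL` at `(O, k, θ)` and (T-k)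
`hFact` stay the only hypotheses, as in the Σ version. [OURS · L1 W4.5b · WIDTH TABLE D13 engine delta, scratch for stub-4 per desk g26-12]; NOT a statement of the manuscript; EL♮(3) NOT proved. -/
theorem hsub_reachNoseTowerBTriplePrimeSigmaPG_of_fact' (k : Type) [Field k]
    (O : Type) [CommRing O] [IsDomain O] [IsDiscreteValuationRing O] [IsAdicComplete (IsLocalRing.maximalIdeal O) O]
    [IsAlgClosed (IsLocalRing.ResidueField O)] (θ : O →+* k) (hθ : Function.Surjective θ)
    (P : Scheme.{0}) (q : P ⟶ Spec (.of O)) (Y : Set P) (Ch : ∀ X' : Scheme.{0}, (X' ⟶ P) → Set X' → Prop)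
    (hChStep : ∀ (X' X'' : Scheme.{0}) (σ' : X' ⟶ P) (S' : Set X') (C : X'.IdealSheafData) (τ : X'' ⟶ X'),
      Ch X' σ' S' → IsBlowup τ C → Scheme.IsRegular C.subscheme → Flat (C.subschemeι ≫ σ' ≫ q) →
      σ' '' (C.support : Set X') ⊆ {y | ¬ IsGenericPoint y Y} → (C.support : Set X') ∩ (σ' ≫ q) ⁻¹' {IsLocalRing.closedPoint O} ⊆ S' →
      Ch X'' (τ ≫ σ') (closure (τ ⁻¹' (S' \ (C.support : Set X')))))
    (hChSplit : ∀ (X' : Scheme.{0}) (σ' : X' ⟶ P) (S' : Set X'), Ch X' σ' S' → Chain P Y X' σ' S')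
    (hYsp : Y ⊆ q ⁻¹' {IsLocalRing.closedPoint O}) (hYirr : IsIrreducible Y) (hYcl : IsClosed Y) (hPint : IsIntegral P)
    (hPnoeth : IsLocallyNoetherian P) (hPreg : Scheme.IsRegular P) (hqprop : IsProper q) (hqsm : SmoothOfRelativeDimension 3 q)
    -- the stage before the nose and its model
    (X' : Scheme.{0}) (σ' : X' ⟶ P) (S' : Set X') (_hCh' : Ch X' σ' S') (_hX'int : IsIntegral X') (hX'noeth : IsLocallyNoetherian X')
    (hX'reg : Scheme.IsRegular X') (_hX'dom : IsDominant (σ' ≫ q)) (F₁ : Scheme.{0}) (hF₁ : IsIntegral F₁) (j : F₁ ⟶ X')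
    (t : F₁ ⟶ Spec (.of k)) (hsq : IsPullback j t (σ' ≫ q) (Spec.map (CommRingCat.ofHom θ))) (T₁ : Set F₁) (_hT₁cl : IsClosed T₁)
    (_hT₁irr : IsIrreducible T₁) (_hjT₁ : j '' T₁ = S')
    -- the NOSE block
    (Z : Set F₁) (hZ : IsClosed Z) (_hZT₁ : Z ⊆ T₁) (hT₁Z : ¬ (T₁ ⊆ Z)) (hZinf : Z.Infinite)
    (hZdim : ∀ z : ↥(redSub F₁ Z hZ), IsClosed ({z} : Set ↥(redSub F₁ Z hZ)) →
      ringKrullDim ((redSub F₁ Z hZ).presheaf.stalk z) = ((1 : ℕ) : WithBot ℕ∞))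
    (C : X'.IdealSheafData) (hCreg : Scheme.IsRegular C.subscheme) (hCfl : Flat (C.subschemeι ≫ σ' ≫ q))
    (hCj : C.comap j = vanishingIdeal (⟨Z, hZ⟩ : Closeds F₁)) (hCoff : ∀ c ∈ (C.support : Set X'), ¬ IsGenericPoint (σ' c) Y)
    (X₁ : Scheme.{0}) (τ₁ : X₁ ⟶ X') (hτ₁ : IsBlowup τ₁ C) (hX₁int : IsIntegral X₁) (hX₁noeth : IsLocallyNoetherian X₁)
    (hX₁reg : Scheme.IsRegular X₁) (hX₁dom : IsDominant ((τ₁ ≫ σ') ≫ q)) (F₂ : Scheme.{0}) (hF₂ : IsIntegral F₂) (υ : F₂ ⟶ F₁)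
    (hυ : IsBlowup υ (vanishingIdeal (⟨Z, hZ⟩ : Closeds F₁))) (j₂ : F₂ ⟶ X₁) (t₂ : F₂ ⟶ Spec (.of k))
    (hsq₂ : IsPullback j₂ t₂ ((τ₁ ≫ σ') ≫ q) (Spec.map (CommRingCat.ofHom θ))) (hcomm : j₂ ≫ τ₁ = υ ≫ j)
    (_hexc : (C.comap τ₁).comap j₂ = (vanishingIdeal (⟨Z, hZ⟩ : Closeds F₁)).comap υ)
    (hirr₂ : IsIrreducible (closure (υ ⁻¹' (T₁ \ Z)))) (hCh₁ : Ch X₁ (τ₁ ≫ σ') (j₂ '' closure (υ ⁻¹' (T₁ \ Z))))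
    -- ===================== THE ONE NAMED INPUT: (T-k), the registered NEED-FACT instantiated over `q` =====================
    -- (T-k) the embedded-curve lift at every stage / exceptional surface over `q` (res-L1-w45b-lead-2 …NatTowerRoundFourDefs p594791)
    (hFact : EmbeddedCurveLift O k θ P q)
    -- the Σ-LICENCE at `(O, k, θ)` (res-L1-w45b-stub-2's binder 0196e0c85d2c112d; WIDTH TABLE D12, desk R74 (i))
    (hSL :
      ∀ {P : Scheme.{0}} (X : Scheme.{0}) (σ : X ⟶ P) (q : P ⟶ Spec (.of O)) (𝓔 : X.IdealSheafData),
        IsIntegral X → IsLocallyNoetherian X → Scheme.IsRegular X → IsProper (σ ≫ q) →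
        (∀ x : X, (stalkIdeal 𝓔 x).IsPrincipal) → 𝓔 ≠ ⊥ →
        Scheme.IsRegular 𝓔.subscheme → Flat (𝓔.subschemeι ≫ σ ≫ q) → IsProper (𝓔.subschemeι ≫ σ ≫ q) →
        ∀ (G : Scheme.{0}) (j : G ⟶ X) (t : G ⟶ Spec (.of k)),
          IsPullback j t (σ ≫ q) (Spec.map (CommRingCat.ofHom θ)) →
          ∀ (E : Set G) (hE : IsClosed E), 𝓔.comap j = vanishingIdeal (⟨E, hE⟩ : Closeds G) →
          ∀ (Z : Set G) (hZ : IsClosed Z), Z ⊆ E →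
            Set.Finite {x : ↥(redSub G Z hZ) | ¬ IsRegularLocalRing ((redSub G Z hZ).presheaf.stalk x)} →
            (∀ z : ↥(redSub G Z hZ), IsClosed ({z} : Set ↥(redSub G Z hZ)) →
              ringKrullDim ((redSub G Z hZ).presheaf.stalk z) = ((1 : ℕ) : WithBot ℕ∞)) →
            (∀ (i : redSub G Z hZ ⟶ redSub G E hE), i ≫ redSubι G E hE = redSubι G Z hZ →
              ∀ z : ↥(redSub G Z hZ), IsClosed ({z} : Set ↥(redSub G Z hZ)) →
                ringKrullDim ((redSub G E hE).presheaf.stalk (i z)) = ((2 : ℕ) : WithBot ℕ∞)) →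
            (∀ z ∈ Z, IsClosed ({z} : Set G) → ∃ f : G.presheaf.stalk z,
              stalkIdeal (vanishingIdeal (⟨Z, hZ⟩ : Closeds G)) z =
                  stalkIdeal (vanishingIdeal (⟨E, hE⟩ : Closeds G)) z ⊔ Ideal.span {f} ∧
                f ∉ stalkIdeal (vanishingIdeal (⟨E, hE⟩ : Closeds G)) z ⊔ (maximalIdeal (G.presheaf.stalk z)) ^ 2) →
            DirStepUnobs G E hE Z hZ →
            ∃ C : X.IdealSheafData, 𝓔 ≤ C ∧ Scheme.IsRegular C.subscheme ∧ Flat (C.subschemeι ≫ σ ≫ q) ∧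
              C.comap j = vanishingIdeal (⟨Z, hZ⟩ : Closeds G)) :
    -- ===================== THE CONCLUSION OF HSUB‴(ReachNoseTowerB‴)₃ =====================
    ∀ (F' : Scheme.{0}) (γ' : F' ⟶ F₂) (T' E' K' : Set F'),
      (∃ Es' Ns' : List (Set F'), ∀ R₁ : (∀ G : Scheme.{0}, (G ⟶ F₂) → Set G → Set G → List (Set G) → List (Set G) → Set G → Prop),
        R₁ F₂ (𝟙 F₂) (closure (υ ⁻¹' (T₁ \ Z))) (υ ⁻¹' Z) [] [] ∅ → TowerPtRegB₄ F₂ R₁ → TowerPtRamB₄ F₂ R₁ →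
        TowerRoundBTriplePrime F₁ F₂ υ Z hZ R₁ → TowerSecRoundSigma F₁ F₂ υ Z hZ R₁ → TowerPRamGamma F₁ F₂ υ Z hZ R₁ →
        R₁ F' γ' T' E' Es' Ns' K') →
      ∃ (X₉ : Scheme.{0}) (σ₉ : X₉ ⟶ P) (S₉ : Set X₉) (j₉ : F' ⟶ X₉) (t₉ : F' ⟶ Spec (.of k)),
        Ch X₉ σ₉ S₉ ∧ IsIntegral X₉ ∧ IsLocallyNoetherian X₉ ∧ Scheme.IsRegular X₉ ∧ IsDominant (σ₉ ≫ q) ∧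
        IsPullback j₉ t₉ (σ₉ ≫ q) (Spec.map (CommRingCat.ofHom θ)) ∧ j₉ '' T' = S₉ ∧ IsClosed T' ∧ IsIrreducible T' ∧ IsIntegral F' := by
  classical
  haveI := hPint
  haveI := hqprop
  haveI := hqsm
  haveI := hX'noeth
  haveI := hX₁int
  haveI := hX₁noeth
  haveI := hF₂
  haveI := hF₁
  -- the exceptional-surface datum of the engine: `O`-FLATNESS of the upstairs model of the running exceptional surface
  let FE : Tower.RuledDatum P := fun _ _ _ _ _ _ _ _ _ σ _ 𝓔 => Flat (𝓔.subschemeι ≫ σ ≫ q)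
  have hFEbirth : ∀ {X X'' : Scheme.{0}} [IsLocallyNoetherian X] (σ : X ⟶ P) (C : X.IdealSheafData) (τ : X'' ⟶ X),
      Scheme.IsRegular X → Scheme.IsRegular C.subscheme → Flat (C.subschemeι ≫ σ ≫ q) → IsBlowup τ C →
      Flat ((C.comap τ).subschemeι ≫ (τ ≫ σ) ≫ q) := by
    intro X X'' _ σ C τ hXreg hCreg hCflat hτ
    rw [Category.assoc]
    exact flat_exceptional_of_isBlowup_regularCentre O X X'' (σ ≫ q) C hXreg hCreg hCflat τ hτ
  -- `F₁` is locally Noetherian (a closed subscheme of `X'`)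
  haveI : IsClosedImmersion (Spec.map (CommRingCat.ofHom θ)) := IsClosedImmersion.spec_of_surjective _ hθ
  haveI : IsClosedImmersion j := MorphismProperty.IsStableUnderBaseChange.of_isPullback hsq.flip inferInstance
  haveI hF₁noeth : IsLocallyNoetherian F₁ := LocallyOfFiniteType.isLocallyNoetherian j
  -- INV₁‴ (B‴-tower, at the datum `FE`): `Tower.InvB₄` ∧ K-side facts ∧ the carrier-dimension datum ∧ `IsLocallyNoetherian F₉` (the V10 shape of p627628/p627682)
  let INV₁ : ∀ (F₉ : Scheme.{0}) (Z₉ : Set F₉), IsClosed Z₉ → ∀ (F₁₀ : Scheme.{0}), (F₁₀ ⟶ F₉) →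
      ∀ G : Scheme.{0}, (G ⟶ F₁₀) → Set G → Set G → List (Set G) → List (Set G) → Set G → Prop :=
    fun F₉ Z₉ hZ₉ F₁₀ υ' G γ T E Es Ns K => (Tower.InvB₄ O k θ P q Y Ch FE F₉ Z₉ hZ₉ F₁₀ υ' G γ T E Es Ns K ∧
      IsClosed K ∧ K ⊆ closure (K \ E) ∧ K ≠ Set.univ) ∧
      (∀ z : ↥(redSub F₉ Z₉ hZ₉), IsClosed ({z} : Set ↥(redSub F₉ Z₉ hZ₉)) →
        ringKrullDim ((redSub F₉ Z₉ hZ₉).presheaf.stalk z) = ((1 : ℕ) : WithBot ℕ∞)) ∧ IsLocallyNoetherian F₉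
  -- (seed): `Tower.inv₂_noseSeed'` at `FE` ⇒ `Inv₃`; the seed surface `υ⁻¹Z` maps ONTO the infinite `Z` ⇒ `¬ NoRound` ⇒ MODEL-CARRYING ⇒ `InvB₄ … [] [] ∅`
  have hseed : INV₁ F₁ Z hZ F₂ υ F₂ (𝟙 F₂) (closure (υ ⁻¹' (T₁ \ Z))) (υ ⁻¹' Z) [] [] ∅ := by
    refine ⟨?_, hZdim, hF₁noeth⟩
    obtain ⟨h₁, h₂⟩ := Tower.inv₂_noseSeed' O k θ hθ P q Y Ch FE X' σ' hX'noeth hX'reg F₁ j t hsq T₁ Z hZ hT₁Z hZinf C hCreg hCj hCoff X₁ τ₁ hτ₁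
      hX₁int hX₁noeth hX₁reg hX₁dom F₂ hF₂ υ hυ j₂ t₂ hsq₂ hcomm hirr₂ hCh₁ (hFEbirth σ' C τ₁ hX'reg hCreg hCfl hτ₁)
    have h₃ := Tower.inv₂_inv₃ O k θ P q Y Ch FE F₁ Z hZ F₂ υ F₂ (𝟙 F₂) _ _ _ h₁
    -- `¬ NoRound`: the image of `υ⁻¹Z` under `𝟙 ≫ υ` is `Z`, infinite
    have hZne : (vanishingIdeal (⟨Z, hZ⟩ : Closeds F₁) : F₁.IdealSheafData) ≠ ⊥ := fun h => by
      have hsupp : ((vanishingIdeal (⟨Z, hZ⟩ : Closeds F₁) : F₁.IdealSheafData).support : Set F₁) = Z :=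
        Scheme.IdealSheafData.coe_support_vanishingIdeal _
      rw [h, Scheme.IdealSheafData.support_bot] at hsupp
      exact hT₁Z (fun t _ => hsupp ▸ trivial)
    have hsurj : Function.Surjective υ :=
      Summit.ResolutionOfSingularities.ResolutionOfSingularities.Theorems.EquisingularLift.surjective_of_isBlowup hυ hZne
    have hno : ¬ Tower.NoRound υ F₂ (𝟙 F₂) (υ ⁻¹' Z) := by
      intro hfin
      apply hZinf
      have himg : ((𝟙 F₂ ≫ υ) '' (υ ⁻¹' Z) : Set F₁) = Z := by
        rw [Category.id_comp]
        exact Set.image_preimage_eq Z hsurj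
      simpa only [Tower.NoRound, himg] using hfin
    obtain ⟨g1, g2, g3, g4, g5, g6, g7, X, σ, S, jG, tG, hCh, hX, hXn, hXr, hdom, hsqG, hTS, hE⟩ := h₃
    exact ⟨⟨g1, g2, g3, g4, g5, g6, g7, fun F hF => by simp at hF, fun F hF => by simp at hF, X, σ, S, jG, tG, hCh, hX, hXn, hXr, hdom,
      hsqG, hTS, fun hE' => Tower.exc₄_of_exc₃_of_not_noRound O P q Y FE (hE hE') hno, fun F hF => by simp at hF⟩, h₂⟩
  -- the three step closures of the B‴ tower on `INV₁‴` (this seat, p627628 / p627682)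
  have hptreg : ∀ (F₉ : Scheme.{0}) (Z₉ : Set F₉) (hZ₉ : IsClosed Z₉) (F₁₀ : Scheme.{0}) (υ' : F₁₀ ⟶ F₉),
      TowerPtRegB₄ F₁₀ (INV₁ F₉ Z₉ hZ₉ F₁₀ υ') := fun F₉ Z₉ hZ₉ F₁₀ υ' =>
    Tower.towerPtRegB₄_invB₁_FE O k θ hθ P q Y hYsp hYirr hYcl hPnoeth hPreg Ch hChStep hChSplit F₉ Z₉ hZ₉ F₁₀ υ'
  have hptram : ∀ (F₉ : Scheme.{0}) (Z₉ : Set F₉) (hZ₉ : IsClosed Z₉) (F₁₀ : Scheme.{0}) (υ' : F₁₀ ⟶ F₉),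
      TowerPtRamB₄ F₁₀ (INV₁ F₉ Z₉ hZ₉ F₁₀ υ') := fun F₉ Z₉ hZ₉ F₁₀ υ' =>
    Tower.towerPtRamB₄_invB₁_FE O k θ hθ P q Y hYsp hYirr hYcl hPnoeth hPreg Ch hChStep hChSplit F₉ Z₉ hZ₉ F₁₀ υ'
  have hround : ∀ (F₉ : Scheme.{0}) (Z₉ : Set F₉) (hZ₉ : IsClosed Z₉) (F₁₀ : Scheme.{0}) (υ' : F₁₀ ⟶ F₉),
      TowerRoundBTriplePrime F₉ F₁₀ υ' Z₉ hZ₉ (INV₁ F₉ Z₉ hZ₉ F₁₀ υ') := fun F₉ Z₉ hZ₉ F₁₀ υ' =>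
    Tower.towerRoundBTriplePrime_invB₄_of_fact' O k θ hθ P q Y hYsp hYirr hYcl hPnoeth hPreg Ch hChStep hChSplit hFact Z₉ hZ₉ υ'
  -- the FOURTH closure (D12): the Σ-section hosted round from the licence
  have hsec : ∀ (F₉ : Scheme.{0}) (Z₉ : Set F₉) (hZ₉ : IsClosed Z₉) (F₁₀ : Scheme.{0}) (υ' : F₁₀ ⟶ F₉),
      TowerSecRoundSigma F₉ F₁₀ υ' Z₉ hZ₉ (INV₁ F₉ Z₉ hZ₉ F₁₀ υ') := fun F₉ Z₉ hZ₉ F₁₀ υ' =>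
    Tower.towerSecRoundSigma_invB₁_of_licence O k θ hθ P q Y hYsp hYirr hYcl hPnoeth hPreg Ch hChStep hChSplit hSL Z₉ hZ₉ υ'
  -- the FIFTH closure (D13): the ramified point step + plane round in its fresh exceptional plane (E-round licence discharged inside)
  have hpg : ∀ (F₉ : Scheme.{0}) (Z₉ : Set F₉) (hZ₉ : IsClosed Z₉) (F₁₀ : Scheme.{0}) (υ' : F₁₀ ⟶ F₉),
      TowerPRamGamma F₉ F₁₀ υ' Z₉ hZ₉ (INV₁ F₉ Z₉ hZ₉ F₁₀ υ') := fun F₉ Z₉ hZ₉ F₁₀ υ' =>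
    Tower.towerPRamGamma_invB₁_FE O k θ hθ P q Y hYsp hYirr hYcl hPnoeth hPreg Ch hChStep hChSplit F₉ Z₉ hZ₉ F₁₀ υ'
  -- the closure at `R₁ := INV₁ F₁ Z hZ F₂ υ`, then (final) := `Tower.invB₄_final ∘ And.left`
  intro F' γ' T' E' K' hcl
  obtain ⟨Es', Ns', hcl⟩ := hcl
  have h' : INV₁ F₁ Z hZ F₂ υ F' γ' T' E' Es' Ns' K' :=
    hcl (INV₁ F₁ Z hZ F₂ υ) hseed (hptreg F₁ Z hZ F₂ υ) (hptram F₁ Z hZ F₂ υ) (hround F₁ Z hZ F₂ υ) (hsec F₁ Z hZ F₂ υ)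
      (hpg F₁ Z hZ F₂ υ)
  exact Tower.invB₄_final O k θ P q Y Ch FE F₁ Z hZ F₂ υ F' γ' T' E' Es' Ns' K' h'.1.1

end Summit.ResolutionOfSingularities.ResolutionOfSingularities.Cruxes.EquisingularLiftNat.Sections

namespace Summit.ResolutionOfSingularities.ResolutionOfSingularities.Cruxes.EquisingularLiftNat.Sections.Equinodal

/-- **ONE NOSE ROUND WITH A Σ+PΓ-TAIL, UPSTAIRS — STAGE-GENERIC** (WIDTH TABLE D13): ✓ `Equinodal.noseRound_stage_of_model` (res-L1-w45b-nose-w1, p702606)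
VERBATIM with the tail clause's extra antecedent `TowerSecRoundSigma F₂ F₃ υ' Z₂ hZ₂ R → TowerPRamGamma F₂ F₃ υ' Z₂ hZ₂ R →` and the Σ-licence `hSL`, fed to `hsub_reachNoseTowerBTriplePrimeSigmaPG_of_fact'`.
[OURS · L1 W4.5b · D12 helper; counted 0; EL♮(3) NOT proved] -/
theorem noseRound_stage_of_model_sigmaPG (hF : EmbeddedCurveLiftFact) (k : Type) [Field k] [IsAlgClosed k]
    (O : Type) [CommRing O] [IsDomain O] [IsDiscreteValuationRing O] [IsAdicComplete (IsLocalRing.maximalIdeal O) O]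
    [IsAlgClosed (IsLocalRing.ResidueField O)] (θ : O →+* k) (hθ : Function.Surjective θ)
    -- the Σ-LICENCE at `(O, k, θ)` (res-L1-w45b-stub-2's binder 0196e0c85d2c112d; WIDTH TABLE D12)
    (hSL :
      ∀ {P : Scheme.{0}} (X : Scheme.{0}) (σ : X ⟶ P) (q : P ⟶ Spec (.of O)) (𝓔 : X.IdealSheafData),
        IsIntegral X → IsLocallyNoetherian X → Scheme.IsRegular X → IsProper (σ ≫ q) →
        (∀ x : X, (stalkIdeal 𝓔 x).IsPrincipal) → 𝓔 ≠ ⊥ →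
        Scheme.IsRegular 𝓔.subscheme → Flat (𝓔.subschemeι ≫ σ ≫ q) → IsProper (𝓔.subschemeι ≫ σ ≫ q) →
        ∀ (G : Scheme.{0}) (j : G ⟶ X) (t : G ⟶ Spec (.of k)),
          IsPullback j t (σ ≫ q) (Spec.map (CommRingCat.ofHom θ)) →
          ∀ (E : Set G) (hE : IsClosed E), 𝓔.comap j = vanishingIdeal (⟨E, hE⟩ : Closeds G) →
          ∀ (Z : Set G) (hZ : IsClosed Z), Z ⊆ E →
            Set.Finite {x : ↥(redSub G Z hZ) | ¬ IsRegularLocalRing ((redSub G Z hZ).presheaf.stalk x)} →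
            (∀ z : ↥(redSub G Z hZ), IsClosed ({z} : Set ↥(redSub G Z hZ)) →
              ringKrullDim ((redSub G Z hZ).presheaf.stalk z) = ((1 : ℕ) : WithBot ℕ∞)) →
            (∀ (i : redSub G Z hZ ⟶ redSub G E hE), i ≫ redSubι G E hE = redSubι G Z hZ →
              ∀ z : ↥(redSub G Z hZ), IsClosed ({z} : Set ↥(redSub G Z hZ)) →
                ringKrullDim ((redSub G E hE).presheaf.stalk (i z)) = ((2 : ℕ) : WithBot ℕ∞)) →
            (∀ z ∈ Z, IsClosed ({z} : Set G) → ∃ f : G.presheaf.stalk z,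
              stalkIdeal (vanishingIdeal (⟨Z, hZ⟩ : Closeds G)) z =
                  stalkIdeal (vanishingIdeal (⟨E, hE⟩ : Closeds G)) z ⊔ Ideal.span {f} ∧
                f ∉ stalkIdeal (vanishingIdeal (⟨E, hE⟩ : Closeds G)) z ⊔ (maximalIdeal (G.presheaf.stalk z)) ^ 2) →
            DirStepUnobs G E hE Z hZ →
            ∃ C : X.IdealSheafData, 𝓔 ≤ C ∧ Scheme.IsRegular C.subscheme ∧ Flat (C.subschemeι ≫ σ ≫ q) ∧
              C.comap j = vanishingIdeal (⟨Z, hZ⟩ : Closeds G))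
    (P : Scheme.{0}) (q : P ⟶ Spec (.of O)) (Y : Set P) (Ch : ∀ X' : Scheme.{0}, (X' ⟶ P) → Set X' → Prop)
    (hChStep : ∀ (X' X'' : Scheme.{0}) (σ' : X' ⟶ P) (S' : Set X') (C : X'.IdealSheafData) (τ : X'' ⟶ X'),
      Ch X' σ' S' → IsBlowup τ C → Scheme.IsRegular C.subscheme → Flat (C.subschemeι ≫ σ' ≫ q) →
      σ' '' (C.support : Set X') ⊆ {y | ¬ IsGenericPoint y Y} → (C.support : Set X') ∩ (σ' ≫ q) ⁻¹' {IsLocalRing.closedPoint O} ⊆ S' →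
      Ch X'' (τ ≫ σ') (closure (τ ⁻¹' (S' \ (C.support : Set X')))))
    (hChSplit : ∀ (X' : Scheme.{0}) (σ' : X' ⟶ P) (S' : Set X'), Ch X' σ' S' → Chain P Y X' σ' S')
    (hYsp : Y ⊆ q ⁻¹' {IsLocalRing.closedPoint O}) (hYirr : IsIrreducible Y) (hYcl : IsClosed Y) (hPint : IsIntegral P)
    (hPnoeth : IsLocallyNoetherian P) (hPreg : Scheme.IsRegular P) (hqprop : IsProper q) (hqsm : SmoothOfRelativeDimension 3 q)
    -- the downstairs stage `(F₂, T₂)` and its nose curve `Z₂` (no map to `ℙ³_k` is needed)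
    (F₂ : Scheme.{0}) (T₂ Z₂ : Set F₂) (hZ₂ : IsClosed Z₂) (hZ₂T : Z₂ ⊆ T₂) (hT₂Z : ¬ (T₂ ⊆ Z₂)) (hZ₂inf : Z₂.Infinite)
    (hZ₂dim : ∀ z : ↥(redSub F₂ Z₂ hZ₂), IsClosed ({z} : Set ↥(redSub F₂ Z₂ hZ₂)) →
      ringKrullDim ((redSub F₂ Z₂ hZ₂).presheaf.stalk z) = ((1 : ℕ) : WithBot ℕ∞))
    -- its upstairs stage WITH a regular `O`-flat model `C` of `Z₂` with reduced trace (the HEND block of ✓ `hsube_of_suppliers`, verbatim)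
    (hmodel : ∃ (X' : Scheme.{0}) (σ' : X' ⟶ P) (S' : Set X') (j : F₂ ⟶ X') (t : F₂ ⟶ Spec (.of k)) (C : X'.IdealSheafData),
        Ch X' σ' S' ∧ IsIntegral X' ∧ IsLocallyNoetherian X' ∧ Scheme.IsRegular X' ∧ IsDominant (σ' ≫ q) ∧ IsIntegral F₂ ∧
        IsPullback j t (σ' ≫ q) (Spec.map (CommRingCat.ofHom θ)) ∧ IsClosed T₂ ∧ IsIrreducible T₂ ∧ j '' T₂ = S' ∧
        Scheme.IsRegular C.subscheme ∧ Flat (C.subschemeι ≫ σ' ≫ q) ∧ C.comap j = vanishingIdeal (⟨Z₂, hZ₂⟩ : Closeds F₂))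
    -- the nose blow-up and the B‴ tail (door clauses verbatim; the reached downstairs stage is `(F₉, T₉)`)
    (F₃ : Scheme.{0}) (υ' : F₃ ⟶ F₂) (hυ' : IsBlowup υ' (vanishingIdeal (⟨Z₂, hZ₂⟩ : Closeds F₂)))
    (F₉ : Scheme.{0}) (γ' : F₉ ⟶ F₃) (T₉ E' : Set F₉) (Es' Ns' : List (Set F₉)) (K' : Set F₉)
    (htail : ∀ R : (∀ G : Scheme.{0}, (G ⟶ F₃) → Set G → Set G → List (Set G) → List (Set G) → Set G → Prop),
        R F₃ (𝟙 F₃) (closure (υ' ⁻¹' (T₂ \ Z₂))) (υ' ⁻¹' Z₂) [] [] ∅ →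
        TowerPtRegB₄ F₃ R → TowerPtRamB₄ F₃ R → TowerRoundBTriplePrime F₂ F₃ υ' Z₂ hZ₂ R → TowerSecRoundSigma F₂ F₃ υ' Z₂ hZ₂ R → TowerPRamGamma F₂ F₃ υ' Z₂ hZ₂ R →
        R F₉ γ' T₉ E' Es' Ns' K') :
    ∃ (X₉ : Scheme.{0}) (σ₉ : X₉ ⟶ P) (S₉ : Set X₉) (j₉ : F₉ ⟶ X₉) (t₉ : F₉ ⟶ Spec (.of k)),
      Ch X₉ σ₉ S₉ ∧ IsIntegral X₉ ∧ IsLocallyNoetherian X₉ ∧ Scheme.IsRegular X₉ ∧ IsDominant (σ₉ ≫ q) ∧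
      IsPullback j₉ t₉ (σ₉ ≫ q) (Spec.map (CommRingCat.ofHom θ)) ∧ j₉ '' T₉ = S₉ ∧ IsClosed T₉ ∧ IsIrreducible T₉ ∧ IsIntegral F₉ ∧
      TCPlus.LetterDatum O P q Y F₉ X₉ σ₉ j₉ (∅ : Set F₉) := by
  classical
  obtain ⟨X', σ', S', j, t, C, hCh', hX'int, hX'noeth, hX'reg, hX'dom, hF₂, hsq, hT₂cl, hT₂irr, hjT₂, hCreg, hCfl, hCj⟩ := hmodel
  subst hjT₂
  haveI := hPint; haveI := hPnoeth; haveI := hX'int; haveI := hX'noeth; haveI := hF₂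
  -- E1-legality of `C` upstairs: off the generic point of `Y` (from the chain and `¬ T₂ ⊆ Z₂`)
  have hoff : σ' '' (C.support : Set X') ⊆ {y : P | ¬ IsGenericPoint y Y} :=
    image_support_subset_not_isGenericPoint_of_chain θ hθ q Y hYsp σ' (j '' T₂) (hChSplit _ _ _ hCh') j t hsq T₂ rfl C Z₂ hZ₂ hCj hT₂Z
  have hCoff : ∀ c ∈ (C.support : Set X'), ¬ IsGenericPoint (σ' c) Y := fun c hc => hoff ⟨c, hc, rfl⟩
  -- the upstairs blow-up of `C` and the model square for the nose blow-up `υ'` (`modelStep_chain`)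
  have hDT : (((vanishingIdeal (⟨Z₂, hZ₂⟩ : Closeds F₂)) : F₂.IdealSheafData).support : Set F₂) ⊆ T₂ := by
    rw [Scheme.IdealSheafData.coe_support_vanishingIdeal]; exact hZ₂T
  have hTD : ¬ T₂ ⊆ (((vanishingIdeal (⟨Z₂, hZ₂⟩ : Closeds F₂)) : F₂.IdealSheafData).support : Set F₂) := by
    rw [Scheme.IdealSheafData.coe_support_vanishingIdeal]; exact hT₂Z
  obtain ⟨X₂, τ₂, hτ₂⟩ := exists_isBlowup X' C
  obtain ⟨hX₂i, hX₂n, hX₂r, hX₂dom, hF₃i, hirr₃, j₃, t₃, hsq₃, hcomm₃, hCh₃⟩ :=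
    modelStep_chain O k θ hθ P q Y hYirr hYcl Ch hChSplit hChStep X' σ' (j '' T₂) hCh' hX'reg hX'dom F₂ j t hsq T₂ rfl
      C (vanishingIdeal (⟨Z₂, hZ₂⟩ : Closeds F₂)) hCj hCreg hCfl hoff hDT hTD X₂ τ₂ hτ₂ F₃ υ' hυ'
  rw [Scheme.IdealSheafData.coe_support_vanishingIdeal] at hirr₃ hCh₃
  have hexc₃ : (C.comap τ₂).comap j₃ = (vanishingIdeal (⟨Z₂, hZ₂⟩ : Closeds F₂)).comap υ' := by
    rw [← Scheme.IdealSheafData.comap_comp, hcomm₃, Scheme.IdealSheafData.comap_comp, hCj]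
  -- the stage-generic nose engine‴ on the B‴ tail, fed with (T-k) at the base `(k, O, θ, P, q)`
  obtain ⟨X₉, σ₉, S₉, j₉, t₉, h1, h2, h3, h4, h5, h6, h7, h8, h9, h10⟩ :=
    hsub_reachNoseTowerBTriplePrimeSigmaPG_of_fact' k O θ hθ P q Y Ch hChStep hChSplit hYsp hYirr hYcl hPint hPnoeth hPreg hqprop hqsm
      X' σ' (j '' T₂) hCh' hX'int hX'noeth hX'reg hX'dom F₂ hF₂ j t hsq T₂ hT₂cl hT₂irr rfl
      Z₂ hZ₂ hZ₂T hT₂Z hZ₂inf hZ₂dim C hCreg hCfl hCj hCoff X₂ τ₂ hτ₂ hX₂i hX₂n hX₂r hX₂dom F₃ hF₃i υ' hυ' j₃ t₃ hsq₃ hcomm₃ hexc₃ hirr₃ hCh₃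
      (hF k O θ hθ P q) hSL F₉ γ' T₉ E' K' ⟨Es', Ns', htail⟩
  -- the host is dropped: the empty letter has the trivial model
  exact ⟨X₉, σ₉, S₉, j₉, t₉, h1, h2, h3, h4, h5, h6, h7, h8, h9, h10, TCPlus.letterDatum_empty O P q Y F₉ X₉ σ₉ j₉⟩

/-- **ONE DIRECT NOSE MOVE WITH A Σ+PΓ-TAIL AT THE INITIAL STAGE, UPSTAIRS** (WIDTH TABLE D13): ✓ `Equinodal.directNose_stage_zero_of_model` (res-L1-w45b-nose-w1)
VERBATIM with the Σ antecedent in the tail clause and the Σ-licence `hSL`: ✓ `hendBlock_stage_zero_of_model` then `noseRound_stage_of_model_sigmaPG`.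
[OURS · L1 W4.5b · D12 helper; counted 0; EL♮(3) NOT proved] -/
theorem directNose_stage_zero_of_model_sigmaPG (hF : EmbeddedCurveLiftFact) (k : Type) [Field k] [IsAlgClosed k] (H : Scheme.{0})
    (ι : H ⟶ (Literature.AlgebraicGeometry.Motives.projectiveSpace 3 k).left)
    (hι : AlgebraicGeometry.IsClosedImmersion ι) (hH : AlgebraicGeometry.IsIntegral H)
    (O : Type) [CommRing O] [IsDomain O] [IsDiscreteValuationRing O] [IsAdicComplete (IsLocalRing.maximalIdeal O) O]
    [IsAlgClosed (IsLocalRing.ResidueField O)] (θ : O →+* k) (hθ : Function.Surjective θ)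
    (hSL :
      ∀ {P : Scheme.{0}} (X : Scheme.{0}) (σ : X ⟶ P) (q : P ⟶ Spec (.of O)) (𝓔 : X.IdealSheafData),
        IsIntegral X → IsLocallyNoetherian X → Scheme.IsRegular X → IsProper (σ ≫ q) →
        (∀ x : X, (stalkIdeal 𝓔 x).IsPrincipal) → 𝓔 ≠ ⊥ →
        Scheme.IsRegular 𝓔.subscheme → Flat (𝓔.subschemeι ≫ σ ≫ q) → IsProper (𝓔.subschemeι ≫ σ ≫ q) →
        ∀ (G : Scheme.{0}) (j : G ⟶ X) (t : G ⟶ Spec (.of k)),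
          IsPullback j t (σ ≫ q) (Spec.map (CommRingCat.ofHom θ)) →
          ∀ (E : Set G) (hE : IsClosed E), 𝓔.comap j = vanishingIdeal (⟨E, hE⟩ : Closeds G) →
          ∀ (Z : Set G) (hZ : IsClosed Z), Z ⊆ E →
            Set.Finite {x : ↥(redSub G Z hZ) | ¬ IsRegularLocalRing ((redSub G Z hZ).presheaf.stalk x)} →
            (∀ z : ↥(redSub G Z hZ), IsClosed ({z} : Set ↥(redSub G Z hZ)) →
              ringKrullDim ((redSub G Z hZ).presheaf.stalk z) = ((1 : ℕ) : WithBot ℕ∞)) →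
            (∀ (i : redSub G Z hZ ⟶ redSub G E hE), i ≫ redSubι G E hE = redSubι G Z hZ →
              ∀ z : ↥(redSub G Z hZ), IsClosed ({z} : Set ↥(redSub G Z hZ)) →
                ringKrullDim ((redSub G E hE).presheaf.stalk (i z)) = ((2 : ℕ) : WithBot ℕ∞)) →
            (∀ z ∈ Z, IsClosed ({z} : Set G) → ∃ f : G.presheaf.stalk z,
              stalkIdeal (vanishingIdeal (⟨Z, hZ⟩ : Closeds G)) z =
                  stalkIdeal (vanishingIdeal (⟨E, hE⟩ : Closeds G)) z ⊔ Ideal.span {f} ∧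
                f ∉ stalkIdeal (vanishingIdeal (⟨E, hE⟩ : Closeds G)) z ⊔ (maximalIdeal (G.presheaf.stalk z)) ^ 2) →
            DirStepUnobs G E hE Z hZ →
            ∃ C : X.IdealSheafData, 𝓔 ≤ C ∧ Scheme.IsRegular C.subscheme ∧ Flat (C.subschemeι ≫ σ ≫ q) ∧
              C.comap j = vanishingIdeal (⟨Z, hZ⟩ : Closeds G)) :
    letI := MvPolynomial.gradedAlgebra (σ := Fin (3 + 1)) (R := O); letI := MvPolynomial.gradedAlgebra (σ := Fin (3 + 1)) (R := k);
    ∀ (φ : MvPolynomial.homogeneousSubmodule (Fin (3 + 1)) O →+*ᵍ MvPolynomial.homogeneousSubmodule (Fin (3 + 1)) k)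
      (hφ' : HomogeneousIdeal.irrelevant (MvPolynomial.homogeneousSubmodule (Fin (3 + 1)) k) ≤ (HomogeneousIdeal.irrelevant (MvPolynomial.homogeneousSubmodule (Fin (3 + 1)) O)).map φ), (∀ s, φ s = MvPolynomial.map θ s) →
    ∀ (Ch : ∀ X' : AlgebraicGeometry.Scheme.{0}, (X' ⟶ (AlgebraicGeometry.Proj (MvPolynomial.homogeneousSubmodule (Fin (3 + 1)) O))) → Set X' → Prop),
      (∀ (X' X'' : AlgebraicGeometry.Scheme.{0}) (σ' : X' ⟶ (AlgebraicGeometry.Proj (MvPolynomial.homogeneousSubmodule (Fin (3 + 1)) O))) (S' : Set X') (C : X'.IdealSheafData) (τ : X'' ⟶ X'), Ch X' σ' S' → Literature.AlgebraicGeometry.Resolution.IsBlowup τ C →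
        Literature.AlgebraicGeometry.Resolution.Scheme.IsRegular C.subscheme → AlgebraicGeometry.Flat (C.subschemeι ≫ σ' ≫ (AlgebraicGeometry.Proj.toSpecZero (MvPolynomial.homogeneousSubmodule (Fin (3 + 1)) O) ≫ AlgebraicGeometry.Spec.map (CommRingCat.ofHom (algebraMap O (MvPolynomial.homogeneousSubmodule (Fin (3 + 1)) O 0))))) → σ' '' (C.support : Set X') ⊆ {y | ¬ IsGenericPoint y (Set.range (ι ≫ AlgebraicGeometry.Proj.map φ hφ' : H ⟶ (AlgebraicGeometry.Proj (MvPolynomial.homogeneousSubmodule (Fin (3 + 1)) O))))} →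
        (C.support : Set X') ∩ (σ' ≫ (AlgebraicGeometry.Proj.toSpecZero (MvPolynomial.homogeneousSubmodule (Fin (3 + 1)) O) ≫ AlgebraicGeometry.Spec.map (CommRingCat.ofHom (algebraMap O (MvPolynomial.homogeneousSubmodule (Fin (3 + 1)) O 0))))) ⁻¹' {IsLocalRing.closedPoint O} ⊆ S' → Ch X'' (τ ≫ σ') (closure (τ ⁻¹' (S' \ (C.support : Set X'))))) → (∀ (X' : AlgebraicGeometry.Scheme.{0}) (σ' : X' ⟶ (AlgebraicGeometry.Proj (MvPolynomial.homogeneousSubmodule (Fin (3 + 1)) O))) (S' : Set X'), Ch X' σ' S' →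
        Summit.ResolutionOfSingularities.ResolutionOfSingularities.Theses.EquisingularLift.Split.Chain (AlgebraicGeometry.Proj (MvPolynomial.homogeneousSubmodule (Fin (3 + 1)) O)) (Set.range (ι ≫ AlgebraicGeometry.Proj.map φ hφ' : H ⟶ (AlgebraicGeometry.Proj (MvPolynomial.homogeneousSubmodule (Fin (3 + 1)) O)))) X' σ' S') → (Set.range (ι ≫ AlgebraicGeometry.Proj.map φ hφ' : H ⟶ (AlgebraicGeometry.Proj (MvPolynomial.homogeneousSubmodule (Fin (3 + 1)) O)))) ⊆ (AlgebraicGeometry.Proj.toSpecZero (MvPolynomial.homogeneousSubmodule (Fin (3 + 1)) O) ≫ AlgebraicGeometry.Spec.map (CommRingCat.ofHom (algebraMap O (MvPolynomial.homogeneousSubmodule (Fin (3 + 1)) O 0)))) ⁻¹' {IsLocalRing.closedPoint O} → IsIrreducible (Set.range (ι ≫ AlgebraicGeometry.Proj.map φ hφ' : H ⟶ (AlgebraicGeometry.Proj (MvPolynomial.homogeneousSubmodule (Fin (3 + 1)) O)))) → IsClosed (Set.range (ι ≫ AlgebraicGeometry.Proj.map φ hφ' : H ⟶ (AlgebraicGeometry.Proj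 (MvPolynomial.homogeneousSubmodule (Fin (3 + 1)) O)))) →
      AlgebraicGeometry.IsIntegral (AlgebraicGeometry.Proj (MvPolynomial.homogeneousSubmodule (Fin (3 + 1)) O)) → IsLocallyNoetherian (AlgebraicGeometry.Proj (MvPolynomial.homogeneousSubmodule (Fin (3 + 1)) O)) → Literature.AlgebraicGeometry.Resolution.Scheme.IsRegular (AlgebraicGeometry.Proj (MvPolynomial.homogeneousSubmodule (Fin (3 + 1)) O)) → AlgebraicGeometry.IsProper (AlgebraicGeometry.Proj.toSpecZero (MvPolynomial.homogeneousSubmodule (Fin (3 + 1)) O) ≫ AlgebraicGeometry.Spec.map (CommRingCat.ofHom (algebraMap O (MvPolynomial.homogeneousSubmodule (Fin (3 + 1)) O 0)))) → AlgebraicGeometry.SmoothOfRelativeDimension 3 (AlgebraicGeometry.Proj.toSpecZero (MvPolynomial.homogeneousSubmodule (Fin (3 + 1)) O) ≫ AlgebraicGeometry.Spec.map (CommRingCat.ofHom (algebraMap O (MvPolynomial.homogeneousSubmodule (Fin (3 + 1)) O 0)))) →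
      -- the INITIAL stage is in the chain
      Ch (AlgebraicGeometry.Proj (MvPolynomial.homogeneousSubmodule (Fin (3 + 1)) O)) (𝟙 (AlgebraicGeometry.Proj (MvPolynomial.homogeneousSubmodule (Fin (3 + 1)) O))) (Set.range (ι ≫ AlgebraicGeometry.Proj.map φ hφ' : H ⟶ (AlgebraicGeometry.Proj (MvPolynomial.homogeneousSubmodule (Fin (3 + 1)) O)))) →
    -- the nose `Z ⊆ range ι` (door clauses: in the surface, not all of it, infinite, curve clause) and its MODEL `𝓦`
    ∀ (Z : Set (Literature.AlgebraicGeometry.Motives.projectiveSpace 3 k).left) (hZ : IsClosed Z),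
      Z ⊆ Set.range ι → ¬ (Set.range ι ⊆ Z) → Z.Infinite →
      (∀ z : ↥(redSub (Literature.AlgebraicGeometry.Motives.projectiveSpace 3 k).left Z hZ), IsClosed ({z} : Set ↥(redSub (Literature.AlgebraicGeometry.Motives.projectiveSpace 3 k).left Z hZ)) →
        ringKrullDim ((redSub (Literature.AlgebraicGeometry.Motives.projectiveSpace 3 k).left Z hZ).presheaf.stalk z) = ((1 : ℕ) : WithBot ℕ∞)) →
    ∀ (𝓦 : (AlgebraicGeometry.Proj (MvPolynomial.homogeneousSubmodule (Fin (3 + 1)) O)).IdealSheafData),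
      Literature.AlgebraicGeometry.Resolution.Scheme.IsRegular 𝓦.subscheme →
      AlgebraicGeometry.Flat (𝓦.subschemeι ≫ (AlgebraicGeometry.Proj.toSpecZero (MvPolynomial.homogeneousSubmodule (Fin (3 + 1)) O) ≫ AlgebraicGeometry.Spec.map (CommRingCat.ofHom (algebraMap O (MvPolynomial.homogeneousSubmodule (Fin (3 + 1)) O 0))))) →
      𝓦.comap (AlgebraicGeometry.Proj.map φ hφ') = vanishingIdeal (⟨Z, hZ⟩ : Closeds (Literature.AlgebraicGeometry.Motives.projectiveSpace 3 k).left) →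
    -- THE MOVE: the nose blow-up at the initial stage and the B‴ tail (door clauses verbatim, `(F₂, T₂, Z₂) := (ℙ³_k, range ι, Z)`)
    ∀ (F₃ : Scheme.{0}) (υ' : F₃ ⟶ (Literature.AlgebraicGeometry.Motives.projectiveSpace 3 k).left),
      IsBlowup υ' (vanishingIdeal (⟨Z, hZ⟩ : Closeds (Literature.AlgebraicGeometry.Motives.projectiveSpace 3 k).left)) →
    ∀ (F₉ : Scheme.{0}) (γ' : F₉ ⟶ F₃) (T₉ E' : Set F₉) (Es' Ns' : List (Set F₉)) (K' : Set F₉),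
      (∀ R : (∀ G : Scheme.{0}, (G ⟶ F₃) → Set G → Set G → List (Set G) → List (Set G) → Set G → Prop),
        R F₃ (𝟙 F₃) (closure (υ' ⁻¹' (Set.range ι \ Z))) (υ' ⁻¹' Z) [] [] ∅ →
        TowerPtRegB₄ F₃ R → TowerPtRamB₄ F₃ R → TowerRoundBTriplePrime (Literature.AlgebraicGeometry.Motives.projectiveSpace 3 k).left F₃ υ' Z hZ R →
        TowerSecRoundSigma (Literature.AlgebraicGeometry.Motives.projectiveSpace 3 k).left F₃ υ' Z hZ R →
        TowerPRamGamma (Literature.AlgebraicGeometry.Motives.projectiveSpace 3 k).left F₃ υ' Z hZ R →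
        R F₉ γ' T₉ E' Es' Ns' K') →
    ∃ (X₉ : Scheme.{0}) (σ₉ : X₉ ⟶ (AlgebraicGeometry.Proj (MvPolynomial.homogeneousSubmodule (Fin (3 + 1)) O))) (S₉ : Set X₉) (j₉ : F₉ ⟶ X₉) (t₉ : F₉ ⟶ AlgebraicGeometry.Spec (.of k)),
      Ch X₉ σ₉ S₉ ∧ AlgebraicGeometry.IsIntegral X₉ ∧ IsLocallyNoetherian X₉ ∧ Literature.AlgebraicGeometry.Resolution.Scheme.IsRegular X₉ ∧ AlgebraicGeometry.IsDominant (σ₉ ≫ (AlgebraicGeometry.Proj.toSpecZero (MvPolynomial.homogeneousSubmodule (Fin (3 + 1)) O) ≫ AlgebraicGeometry.Spec.map (CommRingCat.ofHom (algebraMap O (MvPolynomial.homogeneousSubmodule (Fin (3 + 1)) O 0))))) ∧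
      IsPullback j₉ t₉ (σ₉ ≫ (AlgebraicGeometry.Proj.toSpecZero (MvPolynomial.homogeneousSubmodule (Fin (3 + 1)) O) ≫ AlgebraicGeometry.Spec.map (CommRingCat.ofHom (algebraMap O (MvPolynomial.homogeneousSubmodule (Fin (3 + 1)) O 0))))) (AlgebraicGeometry.Spec.map (CommRingCat.ofHom θ)) ∧ j₉ '' T₉ = S₉ ∧ IsClosed T₉ ∧ IsIrreducible T₉ ∧ AlgebraicGeometry.IsIntegral F₉ ∧
      TCPlus.LetterDatum O (AlgebraicGeometry.Proj (MvPolynomial.homogeneousSubmodule (Fin (3 + 1)) O)) (AlgebraicGeometry.Proj.toSpecZero (MvPolynomial.homogeneousSubmodule (Fin (3 + 1)) O) ≫ AlgebraicGeometry.Spec.map (CommRingCat.ofHom (algebraMap O (MvPolynomial.homogeneousSubmodule (Fin (3 + 1)) O 0)))) (Set.range (ι ≫ AlgebraicGeometry.Proj.map φ hφ' : H ⟶ (AlgebraicGeometry.Proj (MvPolynomial.homogeneousSubmodule (Fin (3 + 1)) O)))) F₉ X₉ σ₉ j₉ (∅ : Set F₉) := by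
  classical
  letI := MvPolynomial.gradedAlgebra (σ := Fin (3 + 1)) (R := O)
  letI := MvPolynomial.gradedAlgebra (σ := Fin (3 + 1)) (R := k)
  intro φ hφ' hφ Ch hChStep hChSplit hYsp hYirr hYcl hPint hPnoeth hPreg hqprop hqsm hCh₀ Z hZ hZT hTZ hZinf hZdim 𝓦 h𝓦reg h𝓦fl h𝓦tr
    F₃ υ' hυ' F₉ γ' T₉ E' Es' Ns' K' htail
  -- the HEND block at the initial stage from the model `𝓦` …
  have hmodel := hendBlock_stage_zero_of_model k H ι hι hH O θ hθ φ hφ' hφ Ch hPint hPnoeth hPreg hCh₀ Z hZ 𝓦 h𝓦reg h𝓦fl h𝓦tr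
  -- … then PHASE 2 on it
  exact noseRound_stage_of_model_sigmaPG hF k O θ hθ hSL _ _ _ Ch hChStep hChSplit hYsp hYirr hYcl hPint hPnoeth hPreg hqprop hqsm
    (Literature.AlgebraicGeometry.Motives.projectiveSpace 3 k).left (Set.range ι) Z hZ hZT hTZ hZinf hZdim hmodel F₃ υ' hυ' F₉ γ' T₉ E' Es' Ns' K' htail


end Summit.ResolutionOfSingularities.ResolutionOfSingularities.Cruxes.EquisingularLiftNat.Sections.Equinodal

end
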